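import Literature.AlgebraicGeometry.HodgeTheory.HodgeTypeDimension
import Literature.AlgebraicGeometry.HodgeTheory.HodgeTypeConjugation
import Literature.AlgebraicGeometry.HodgeTheory.HolomorphicBundleChernCharacterTopDegree
import Literature.NumberTheory.Transcendental.KaehlerHodgeStarTypeProofs
import HarnessLib

/-!
# No classes of Hodge type `(p, q)` with `p > dim X` or `q > dim X`; a class of two different types is zero

Family `hodge`, layer `Literature/AlgebraicGeometry/HodgeTheory`. Companion to `HodgeTypeDimension`
(which proves the vanishing of classes of type `(p, 0)`, `p > n`, and `(0, q)`, `q > n`, and leaves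
the MIXED types `(p, q)`, `p > n`, `q > 0` aside: "equally zero, but the tree's weight-based `IsOfType`
needs the full type decomposition to see it"). The tree has since acquired exactly that:
`IsOfType.eq_zero_of_finrank_lt_or_lt` (`KaehlerHodgeStarTypeProofs`: on a manifold with a Hermitian
metric, a `k`-form of type `(p, q)` with `p > dim_ℂ` or `q > dim_ℂ` vanishes — `⋆α` has weight
`p - q` with `|p - q|` exceeding its degree). Every Hodge model of a smooth projective `X` carries a
Hermitian (indeed Kähler) metric, the restricted Fubini–Study metric of a projective embedding
(`HodgeModel.exists_isKaehler_kaehlerForm_eq_fubiniStudyPullbackForm`), whence: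

* `HodgeModel.hodgePQ_eq_bot_of_lt` — in a Hodge model of a smooth projective `n`-fold,
  `H^{p,q} = 0` whenever `p > n` or `q > n` ("`Ω^{p,q}_X = Λ^p Ω^{1,0} ⊗ Λ^q Ω^{0,1}`", Voisin I §2.3.1);
* `IsOfHodgeType.eq_zero_of_lt` — **a class in `Hᵏ(X(ℂ); ℂ)` of Hodge type `(p, q)` with `p > n` or
  `q > n` is zero** (e.g. a product `x ⌣ x' ⌣ h^{n-1}`, `x, x'` of type `(1, 0)`, has type `(n+1, n-1)`
  in the top degree and vanishes — the orthogonality `H(H^{1,0}, H^{0,1}) = 0` of the Hermitian form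
  `i H₁(α, β̄)` of Voisin I Lemma 6.31 / §7.1.2 (i));
* `IsOfHodgeType.eq_zero_of_ne` — **a class of two DIFFERENT Hodge types `(p, q) ≠ (p', q')` is
  zero** ("the `H^{p,q}` are in direct sum", Voisin I Cor. 6.14: the field `isInternal_hodgePQ` of a
  Hodge model and the model-independence `hodgePQ_independent_of_hodgeModel_holds`; the tree's
  `eq_zero_of_isOfHodgeType_one_zero_of_zero_one` is the case `k = 1`).

No definition and no named fact is introduced (D-0026).

## References

* [VoisinHodgeI2002] C. Voisin, Hodge Theory and Complex Algebraic Geometry I (CUP 2002), §2.3.1,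
  Cor. 6.14, Lemma 6.31, §7.1.2.
* [Huybrechts2005] D. Huybrechts, Complex Geometry (Springer 2005), Lemma 1.2.24, §3.3.
-/

noncomputable section

open scoped Manifold ContDiff
open CategoryTheory Bundle Module
open Literature.Geometry.Kaehler
open Literature.NumberTheory.Transcendental

-- The identification `TangentSpace I x = E` is an abuse of definitional equality; as in the tree's
-- tangent-bundle files we let `isDefEq` unfold it.
set_option backward.isDefEq.respectTransparency false

namespace Literature.AlgebraicGeometry.HodgeTheory

section HodgeTheory

variable {n : ℕ} {X : Motives.SchemeOver ℂ}

/-- **`H^{p,q}(X^an) = 0` for `p > n` or `q > n`** in every Hodge model `A` of a smooth projective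
`n`-fold: with the restricted Fubini–Study metric (Hermitian) and the model-space orientation, every
closed `(p,q)`-form vanishes (`IsOfType.eq_zero_of_finrank_lt_or_lt`, `dim_ℂ A.model = n`), so the
span `H^{p,q}` of their classes is `⊥` (in degrees `k > 2n` there are no `k`-forms at all,
`HodgeModel.hodgePQ_eq_bot_of_two_mul_lt`). [cite: VoisinHodgeI2002, §2.3.1] [cite: Huybrechts2005, Lemma 1.2.24] -/
theorem HodgeModel.hodgePQ_eq_bot_of_lt (A : HodgeModel n X) (hX : Motives.IsSmoothProjective n X)
    (k : ℕ) {p q : ℕ} (hlt : n < p ∨ n < q) : A.hodgePQ k p q = ⊥ := by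
  by_cases hk : 2 * n < k
  · exact A.hodgePQ_eq_bot_of_two_mul_lt hk p q
  rw [A.hodgePQ_eq_bot_iff, Literature.NumberTheory.Transcendental.hodgePQ, Submodule.span_eq_bot]
  rintro _ ⟨α, hα, rfl⟩
  -- a Hermitian metric and an orientation on the model
  obtain ⟨N, ι, _⟩ := hX.isProjectiveOver
  obtain ⟨g, hg, -⟩ := A.exists_isKaehler_kaehlerForm_eq_fubiniStudyPullbackForm hX ι
  letI : RiemannianBundle (fun x : A.carrier ↦ TangentSpace 𝓘(ℝ, A.model) x) := ⟨g.toRiemannianMetric⟩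
  haveI : Fact (finrank ℝ A.model = finrank ℝ A.model) := ⟨rfl⟩
  let o : (x : A.carrier) → Orientation ℝ (TangentSpace 𝓘(ℝ, A.model) x) (Fin (finrank ℝ A.model)) :=
    fun _ ↦ (modelBasis A.model (finrank ℝ A.model)).orientation
  have hH : ∀ (x : A.carrier) (v w : TangentSpace 𝓘(ℝ, A.model) x),
      inner ℝ (tangentJ A.model x v) (tangentJ A.model x w) = inner ℝ v w :=
    fun x v w ↦ hg.isHermitian x v w
  have hdim : finrank ℂ A.model = n := A.isAnalytification.finrank_eq
  have hreal : finrank ℝ A.model = 2 * n := by rw [finrank_real_of_complex, hdim]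
  have h : k + (2 * n - k) = finrank ℝ A.model := by omega
  have h0 : (α : MForm 𝓘(ℝ, A.model) A.carrier ℂ k) = 0 :=
    hα.eq_zero_of_finrank_lt_or_lt o hH h (by rw [hdim]; exact hlt)
  have hz : α = 0 := Subtype.ext h0
  rw [hz, map_zero]

/-- **A class of Hodge type `(p, q)` with `p > dim X` or `q > dim X` is zero** (`X` smooth
projective): its pull-back to a Hodge model lies in `H^{p,q} = 0` (`HodgeModel.hodgePQ_eq_bot_of_lt`)
and the pull-back is injective. In particular products of `(1,0)`-classes against `h^{n-1}` in the
top degree — type `(n+1, n-1)` — vanish: the orthogonality of `H^{1,0}` and `H^{0,1}` for Voisin's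
Hermitian form `H₁`. [cite: VoisinHodgeI2002, §2.3.1, Lemma 6.31 and §7.1.2 (i)] -/
theorem IsOfHodgeType.eq_zero_of_lt (hX : Motives.IsSmoothProjective n X) {k p q : ℕ}
    {c : Literature.AlgebraicTopology.SingularHomology.singularCohomology ℂ ℂ (Motives.ComplexPoints X) k}
    (hc : IsOfHodgeType n X k p q c) (hlt : n < p ∨ n < q) : c = 0 := by
  obtain ⟨A, hA⟩ := hc
  rw [A.hodgePQ_eq_bot_of_lt hX k hlt, Submodule.mem_bot] at hA
  exact A.pullback_injective k (by rw [hA, map_zero])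

/-- **A class of two different Hodge types is zero** (`X` smooth projective): if `c ∈ Hᵏ(X(ℂ); ℂ)`
is of type `(p, q)` and of type `(p', q')` with `(p, q) ≠ (p', q')`, then `c = 0` — the pieces
`H^{p,q}`, `p + q = k`, of a Hodge model are independent (field `isInternal_hodgePQ`), all models cut
out the same pieces (`hodgePQ_independent_of_hodgeModel_holds`), and for `p + q ≠ k` the piece is `⊥`.
The case `k = 1` is the tree's `eq_zero_of_isOfHodgeType_one_zero_of_zero_one`.
[cite: VoisinHodgeI2002, Cor. 6.14] -/
theorem IsOfHodgeType.eq_zero_of_ne (hX : Motives.IsSmoothProjective n X) {k p q p' q' : ℕ}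
    {c : Literature.AlgebraicTopology.SingularHomology.singularCohomology ℂ ℂ (Motives.ComplexPoints X) k}
    (hc : IsOfHodgeType n X k p q c) (hc' : IsOfHodgeType n X k p' q' c) (hne : (p, q) ≠ (p', q')) :
    c = 0 := by
  obtain ⟨A, hA⟩ := hc
  have hA' : A.pullback k c ∈ A.hodgePQ k p' q' := hc'.mem_hodgePQ hX A
  -- off the antidiagonal the pieces vanish
  by_cases hpq : p + q = k
  swap
  · have hbot : A.hodgePQ k p q = ⊥ :=
      (A.hodgePQ_eq_bot_iff k p q).2 (Literature.NumberTheory.Transcendental.hodgePQ_eq_bot_of_ne hpq)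
    rw [hbot, Submodule.mem_bot] at hA
    exact A.pullback_injective k (by rw [hA, map_zero])
  by_cases hpq' : p' + q' = k
  swap
  · have hbot : A.hodgePQ k p' q' = ⊥ :=
      (A.hodgePQ_eq_bot_iff k p' q').2 (Literature.NumberTheory.Transcendental.hodgePQ_eq_bot_of_ne hpq')
    rw [hbot, Submodule.mem_bot] at hA'
    exact A.pullback_injective k (by rw [hA', map_zero])
  -- on the antidiagonal: independence of the Hodge pieces
  set T : ↥(Finset.HasAntidiagonal.antidiagonal k) →
      Submodule ℂ (Literature.NumberTheory.Transcendental.complexDeRhamCohomology A.model A.carrier k) :=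
    fun i ↦ Literature.NumberTheory.Transcendental.hodgePQ A.model A.carrier k i.1.1 i.1.2 with hT
  have hind : iSupIndep T := (A.isInternal_hodgePQ k).submodule_iSupIndep
  let i : ↥(Finset.HasAntidiagonal.antidiagonal k) := ⟨(p, q), Finset.HasAntidiagonal.mem_antidiagonal.2 hpq⟩
  let i' : ↥(Finset.HasAntidiagonal.antidiagonal k) :=
    ⟨(p', q'), Finset.HasAntidiagonal.mem_antidiagonal.2 hpq'⟩
  have hii : i ≠ i' := fun h ↦ hne (congrArg Subtype.val h)
  have hdisj : Disjoint (T i) (T i') := hind.pairwiseDisjoint hii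
  obtain ⟨w, hw, hwc⟩ := Submodule.mem_map.1 hA
  obtain ⟨w', hw', hwc'⟩ := Submodule.mem_map.1 hA'
  have hww : w = w' := (A.deRham A.carrier k).injective (hwc.trans hwc'.symm)
  have hw₁ : w ∈ T i := hw
  have hw₂ : w ∈ T i' := hww ▸ hw'
  have hw0 : w = 0 := (Submodule.disjoint_def.1 hdisj) w hw₁ hw₂
  apply A.pullback_injective k
  rw [map_zero, ← hwc, hw0, map_zero]

end HodgeTheory

end Literature.AlgebraicGeometry.HodgeTheory

end
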